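import Summits.NavierStokesRegularity.NavierStokesRegularity.Theorems.TypeIliouvilleNoTypeII.Negative.NSISuperCascadePowerGaugeD
import Literature.Analysis.FluidPDE.SuitableWeakRescaling
import Literature.Analysis.FluidPDE.ClassicalNSIRescale
import HarnessLib

/-!
# The ancient Euler-self-similar NSI cascade, I: windows, levels, existence

Negative-lane support file for `stmt-NavierStokesRegularity-0056` (kill-kit, model class M2′),
bearing on the crux `PowerGaugeEulerLiouville` (item 19832) of the §B route `EulerZoomLiouville`.
On Seregin's Euler line `a = τ^{-(1+ρ)}` the super-similar NSI cascade `𝔲 = glueG T σ τ a z u`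
is discretely self-similar under the EULER scaling about its blow-up point `z₀ = (T₀, x₀)`:
`𝔲(T₀ - σ²s, x₀ + τy) = a 𝔲(T₀ - s, x₀ + y)` (`glueG_eulerDSS`), with `σ² = a⁻¹τ`, i.e.
`(α, β, γ) = (a⁻¹, σ², τ)`, `β = αγ` — the scaling that leaves `ν = 0` invariant. Zooming OUT
along this symmetry produces the **ancient** field
`𝔘(s, y) = a^{-n} 𝔲(T₀ + σ^{2n}s, x₀ + τⁿy)` on the window `σ^{2n}s ≥ -T₀` (independent of `n`
by the DSS, `levelField_consistent`), defined for all `s ∈ ℝ`, vanishing for `s ≥ 0`, and with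
`𝔘(σ²s, τy) = a 𝔘(s, y)` in both directions.

This file: the windows and their exhaustion of the time line (`exists_window_index`), the
Euler scaling constants of level `n` and the exact absorption of the Jacobian by the three gauge
bounds (`window_scaling_A/E/D`), the consistency of the levels and the existence of `𝔘`
(`exists_ancientGlue`, characterised by its window property — no new definition), and the window
formulas for the pressure `p̃[𝔘(s)]` and the derivative `D𝔘(s)` (`ancient_pressure_slice`,
`ancient_fderiv_slice`). Part II (`NSIAncientCascadeGauges`) derives Seregin's power gauges of `𝔘`
at every centre and scale; part III (`NSIAncientCascadeLiouville`) shows that `𝔘` satisfies every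
hypothesis of `PowerGaugeEulerLiouville` except the momentum identity (with the pressure LAW
`p = p̃[𝔘]` in its place) and is not a.e. zero.
WHAT THIS IS NOT: nothing about NS/Euler solutions; no new definitions (𝔘 is produced by an
existence lemma and used through its characterising window property).

References: Seregin, arXiv:2402.13229 (2024), (1.7), Thm 3.1; Ożański, arXiv:1709.00602 (2017),
§2 [`Ozanski2017NSISingular`]; Scheffer 1985, Lemma 2.3; CKN 1982, §2 (scaling).
-/

noncomputable section

open MeasureTheory Set Function Filter Topology Metric Module
open scoped ENNReal NNReal

set_option linter.dupNamespace false

namespace Summit.NavierStokesRegularity.NavierStokesRegularity.Theorems.TypeIliouvilleNoTypeIINegative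

open Literature.Analysis.FluidPDE Literature.Barriers.NavierStokesRegularity
open Literature.Barriers.NavierStokesRegularity.Scheffer TopologicalSpace

/-! ### Generic: affine preimages of cylinders -/

section Preimage

/-- The space–time affine map `Φ(s,y) = (t₀ + βs, x₀ + γy)` pulls the cylinder
`ℝ × B(x₀ + γx', γr)` back to `ℝ × B(x', r)`. [folklore] -/
theorem preimage_stAffine_univ_prod_ball (β : ℝ) {γ : ℝ} (hγ : 0 < γ) (t₀ : ℝ)
    (x₀ x' : EuclideanSpace ℝ (Fin 3)) (r : ℝ) :
    stAffine β γ t₀ x₀ ⁻¹' ((univ : Set ℝ) ×ˢ ball (x₀ + γ • x') (γ * r)) =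
      (univ : Set ℝ) ×ˢ ball x' r := by
  ext ⟨s, y⟩
  simp only [mem_preimage, stAffine_apply, mem_prod, mem_univ, true_and, mem_ball, dist_eq_norm,
    add_sub_add_left_eq_sub, ← smul_sub, norm_smul, Real.norm_of_nonneg hγ.le]
  exact ⟨fun h => lt_of_mul_lt_mul_left h hγ.le, fun h => mul_lt_mul_of_pos_left h hγ⟩

/-- The spatial affine map `y ↦ x₀ + γy` pulls `B(x₀ + γx', γr)` back to `B(x', r)`. [folklore] -/
theorem preimage_space_affine_ball' {γ : ℝ} (hγ : 0 < γ) (x₀ x' : EuclideanSpace ℝ (Fin 3))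
    (r : ℝ) :
    (fun y : EuclideanSpace ℝ (Fin 3) => x₀ + γ • y) ⁻¹' ball (x₀ + γ • x') (γ * r) = ball x' r := by
  ext y
  simp only [mem_preimage, mem_ball, dist_eq_norm, add_sub_add_left_eq_sub, ← smul_sub, norm_smul,
    Real.norm_of_nonneg hγ.le]
  exact ⟨fun h => lt_of_mul_lt_mul_left h hγ.le, fun h => mul_lt_mul_of_pos_left h hγ⟩

end Preimage


namespace IsSuperBlock

variable {T ν₀ τ σ a : ℝ} {z : EuclideanSpace ℝ (Fin 3)} {G : Set (EuclideanSpace ℝ (Fin 3))}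
  {u : ℝ → EuclideanSpace ℝ (Fin 3) → EuclideanSpace ℝ (Fin 3)} {ρ : ℝ}

/-! ### Windows -/

/-- For every `S` some Euler window `σ^{2n} S < T₀` (`σ < 1`). [folklore] -/
theorem exists_window (h : IsSuperBlock T ν₀ τ σ a z G u) (S : ℝ) :
    ∃ n : ℕ, σ ^ (2 * n) * S < blowupTime T σ := by
  have hT₀ := h.blowupTime_pos'
  rcases le_or_gt S 0 with hS | hS
  · exact ⟨0, by simp only [mul_zero, pow_zero, one_mul]; linarith⟩
  · obtain ⟨n, hn⟩ := exists_pow_lt_of_lt_one (div_pos hT₀ hS)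
      (by nlinarith [h.σ_pos, h.σ_lt_one] : σ ^ 2 < 1)
    refine ⟨n, ?_⟩
    rw [← pow_mul] at hn
    exact (lt_div_iff₀ hS).1 hn

/-- **The windows exhaust the time line**: every `s ∈ ℝ` lies in some window
`-T₀ < σ^{2n} s`. [folklore] -/
theorem exists_window_index (h : IsSuperBlock T ν₀ τ σ a z G u) (s : ℝ) :
    ∃ n : ℕ, -blowupTime T σ < σ ^ (2 * n) * s := by
  obtain ⟨n, hn⟩ := h.exists_window (-s)
  exact ⟨n, by linarith [mul_neg (σ ^ (2 * n)) s]⟩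

/-- The windows increase with the level. [folklore] -/
theorem window_succ (h : IsSuperBlock T ν₀ τ σ a z G u) {n : ℕ} {s : ℝ}
    (hs : -blowupTime T σ < σ ^ (2 * n) * s) : -blowupTime T σ < σ ^ (2 * (n + 1)) * s := by
  have hσ2 : 0 < σ ^ 2 := pow_pos h.σ_pos 2
  have hσ21 : σ ^ 2 ≤ 1 := by nlinarith [h.σ_pos, h.σ_lt_one]
  rw [show σ ^ (2 * (n + 1)) * s = σ ^ 2 * (σ ^ (2 * n) * s) by ring]
  rcases le_or_gt 0 (σ ^ (2 * n) * s) with h0 | h0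
  · linarith [h.blowupTime_pos', mul_nonneg hσ2.le h0]
  · nlinarith

/-- The windows increase with the level (any number of steps). [folklore] -/
theorem window_add (h : IsSuperBlock T ν₀ τ σ a z G u) {n : ℕ} {s : ℝ}
    (hs : -blowupTime T σ < σ ^ (2 * n) * s) (k : ℕ) : -blowupTime T σ < σ ^ (2 * (n + k)) * s := by
  induction k with
  | zero => simpa using hs
  | succ k ih => exact h.window_succ ih

/-! ### The Euler scaling constants of level `n` -/

/-- `a^{-n} = (τⁿ)^{1+ρ}`. [folklore] -/
theorem inv_gain_pow_eq_rpow (h : IsSuperBlock T ν₀ τ σ a z G u) (hρ : a = τ ^ (-(1 + ρ)))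
    (n : ℕ) : (a⁻¹) ^ n = (τ ^ n) ^ (1 + ρ) := by
  rw [inv_pow, h.gain_pow_eq_rpow hρ, Real.rpow_neg (pow_pos h.τ_pos n).le, inv_inv]

/-- `σ^{2n} = a^{-n} τⁿ` (`β = αγ`: the Euler scaling leaves `ν = 0` invariant). [folklore] -/
theorem σ_pow_two_mul_eq_inv_gain_mul (h : IsSuperBlock T ν₀ τ σ a z G u) (n : ℕ) :
    σ ^ (2 * n) = (a⁻¹) ^ n * τ ^ n := by
  rw [pow_mul, h.σ_sq, ← mul_pow, div_eq_inv_mul]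

/-- Scale invariance of the `A`-bound: `(a^{-n})² (τⁿ)^{-3} (τⁿ)^{1-2ρ} = 1`. [folklore] -/
theorem window_scaling_A (h : IsSuperBlock T ν₀ τ σ a z G u) (hρ : a = τ ^ (-(1 + ρ))) (n : ℕ) :
    ((a⁻¹) ^ n) ^ 2 * ((τ ^ n) ^ 3)⁻¹ * (τ ^ n) ^ (1 - 2 * ρ) = 1 := by
  have ht : 0 < τ ^ n := pow_pos h.τ_pos n
  rw [h.inv_gain_pow_eq_rpow hρ, ← Real.rpow_natCast ((τ ^ n) ^ (1 + ρ)) 2,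
    ← Real.rpow_mul ht.le, ← Real.rpow_natCast (τ ^ n) 3, ← Real.rpow_neg ht.le,
    ← Real.rpow_add ht, ← Real.rpow_add ht]
  have key : ∀ e : ℝ, e = 0 → (τ ^ n) ^ e = 1 := fun e he => by rw [he, Real.rpow_zero]
  exact key _ (by push_cast; ring)

/-- Scale invariance of the `E`-bound: `(a^{-n}τⁿ)² (σ^{2n}(τⁿ)³)⁻¹ (τⁿ)^{1-ρ} = 1`. [folklore] -/
theorem window_scaling_E (h : IsSuperBlock T ν₀ τ σ a z G u) (hρ : a = τ ^ (-(1 + ρ))) (n : ℕ) :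
    ((a⁻¹) ^ n * τ ^ n) ^ 2 * (σ ^ (2 * n) * (τ ^ n) ^ 3)⁻¹ * (τ ^ n) ^ (1 - ρ) = 1 := by
  have ht : 0 < τ ^ n := pow_pos h.τ_pos n
  rw [h.σ_pow_two_mul_eq_rpow hρ, h.inv_gain_pow_eq_rpow hρ,
    show (τ ^ n) ^ (1 + ρ) * τ ^ n = (τ ^ n) ^ (1 + ρ) * (τ ^ n) ^ (1 : ℝ) by rw [Real.rpow_one],
    ← Real.rpow_add ht, ← Real.rpow_natCast ((τ ^ n) ^ (1 + ρ + 1)) 2, ← Real.rpow_mul ht.le,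
    ← Real.rpow_natCast (τ ^ n) 3, ← Real.rpow_add ht, ← Real.rpow_neg ht.le, ← Real.rpow_add ht,
    ← Real.rpow_add ht]
  have key : ∀ e : ℝ, e = 0 → (τ ^ n) ^ e = 1 := fun e he => by rw [he, Real.rpow_zero]
  exact key _ (by push_cast; ring)

/-- Scale invariance of the `D`-bound: `((a^{-n})²)^{3/2} (σ^{2n}(τⁿ)³)⁻¹ (τⁿ)^{2-2ρ} = 1`.
[folklore] -/
theorem window_scaling_D (h : IsSuperBlock T ν₀ τ σ a z G u) (hρ : a = τ ^ (-(1 + ρ))) (n : ℕ) :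
    (((a⁻¹) ^ n) ^ 2) ^ (3 / 2 : ℝ) * (σ ^ (2 * n) * (τ ^ n) ^ 3)⁻¹ * (τ ^ n) ^ (2 - 2 * ρ) = 1 := by
  have ht : 0 < τ ^ n := pow_pos h.τ_pos n
  rw [h.σ_pow_two_mul_eq_rpow hρ, h.inv_gain_pow_eq_rpow hρ,
    ← Real.rpow_natCast ((τ ^ n) ^ (1 + ρ)) 2, ← Real.rpow_mul ht.le,
    ← Real.rpow_mul ht.le, ← Real.rpow_natCast (τ ^ n) 3, ← Real.rpow_add ht, ← Real.rpow_neg ht.le,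
    ← Real.rpow_add ht, ← Real.rpow_add ht]
  have key : ∀ e : ℝ, e = 0 → (τ ^ n) ^ e = 1 := fun e he => by rw [he, Real.rpow_zero]
  exact key _ (by push_cast; ring)

/-! ### The levels `𝔚_n = a^{-n} 𝔲 ∘ Φ_n` and their consistency -/

/-- **Consistency of the levels** (two-sided Euler DSS): on the window `σ^{2m}s ≥ -T₀` the
level-`(m+k)` field `a^{-(m+k)} 𝔲(T₀ + σ^{2(m+k)}s, x₀ + τ^{m+k}y)` equals the level-`m` field
(`glueG_eulerDSS_iterate`). [cite: Ozanski2017NSISingular, §2 (2.4)] -/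
theorem levelField_consistent (h : IsSuperBlock T ν₀ τ σ a z G u) {m : ℕ} {s : ℝ}
    (hs : -blowupTime T σ ≤ σ ^ (2 * m) * s) (k : ℕ) :
    ((a⁻¹) ^ (m + k) • stPull (σ ^ (2 * (m + k))) (τ ^ (m + k)) (blowupTime T σ) (blowupPoint τ z)
        (glueG T σ τ a z u)) s =
      ((a⁻¹) ^ m • stPull (σ ^ (2 * m)) (τ ^ m) (blowupTime T σ) (blowupPoint τ z)
        (glueG T σ τ a z u)) s := by
  funext y
  rw [smul_stPull_apply, smul_stPull_apply]
  have key := h.glueG_eulerDSS_iterate (s := -(σ ^ (2 * m) * s)) (by linarith) (τ ^ m • y) k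
  have e1 : blowupTime T σ + σ ^ (2 * (m + k)) * s =
      blowupTime T σ - σ ^ (2 * k) * -(σ ^ (2 * m) * s) := by
    rw [mul_add, pow_add]; ring
  have e2 : blowupPoint τ z + τ ^ (m + k) • y = blowupPoint τ z + τ ^ k • τ ^ m • y := by
    rw [smul_smul, ← pow_add, add_comm k m]
  rw [e1, e2, key, sub_neg_eq_add, smul_smul, pow_add, mul_assoc, ← mul_pow,
    inv_mul_cancel₀ h.gain_pos.ne', one_pow, mul_one]

/-- **The ancient Euler-self-similar cascade exists**: there is a field `𝔘 : ℝ × ℝ³ → ℝ³` which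
on every window `σ^{2n}s ≥ -T₀` is the level-`n` zoom-out `a^{-n} 𝔲(T₀ + σ^{2n}s, x₀ + τⁿy)` of
the cascade (well defined by `levelField_consistent`; the windows exhaust `ℝ`). This window
property characterises `𝔘` and is the only way it is used below. [cite: Ozanski2017NSISingular, §2] -/
theorem exists_ancientGlue (h : IsSuperBlock T ν₀ τ σ a z G u) :
    ∃ U : ℝ → EuclideanSpace ℝ (Fin 3) → EuclideanSpace ℝ (Fin 3), ∀ (n : ℕ) (s : ℝ),
      -blowupTime T σ ≤ σ ^ (2 * n) * s →
        U s = ((a⁻¹) ^ n • stPull (σ ^ (2 * n)) (τ ^ n) (blowupTime T σ) (blowupPoint τ z)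
          (glueG T σ τ a z u)) s := by
  have hex : ∀ s : ℝ, ∃ n : ℕ, -blowupTime T σ ≤ σ ^ (2 * n) * s :=
    fun s => (h.exists_window_index s).imp fun n hn => hn.le
  refine ⟨fun s => ((a⁻¹) ^ (hex s).choose • stPull (σ ^ (2 * (hex s).choose)) (τ ^ (hex s).choose)
    (blowupTime T σ) (blowupPoint τ z) (glueG T σ τ a z u)) s, fun n s hn => ?_⟩
  have hm := (hex s).choose_spec
  rcases le_total (hex s).choose n with hle | hle
  · obtain ⟨k, rfl⟩ := Nat.exists_eq_add_of_le hle
    exact (h.levelField_consistent hm k).symm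
  · obtain ⟨k, hk⟩ := Nat.exists_eq_add_of_le hle
    simp only [hk]
    exact h.levelField_consistent hn k

/-! ### Slices of `𝔘` on a window: pressure and derivative -/

section Ancient

variable {U : ℝ → EuclideanSpace ℝ (Fin 3) → EuclideanSpace ℝ (Fin 3)}

/-- On a window, `p̃[𝔘(s)] = a^{-2n} p̃[𝔲(T₀ + σ^{2n}s)] ∘ (x₀ + τⁿ·)`
(`normalisedPressure_smul_stPull_slice`). [cite: Ozanski2017NSISingular, §2 (2.4)] -/
theorem ancient_pressure_slice (h : IsSuperBlock T ν₀ τ σ a z G u)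
    (hU : ∀ (n : ℕ) (s : ℝ), -blowupTime T σ ≤ σ ^ (2 * n) * s →
      U s = ((a⁻¹) ^ n • stPull (σ ^ (2 * n)) (τ ^ n) (blowupTime T σ) (blowupPoint τ z)
        (glueG T σ τ a z u)) s)
    {n : ℕ} {s : ℝ} (hs : -blowupTime T σ ≤ σ ^ (2 * n) * s) :
    normalisedPressure (U s) = fun y => ((a⁻¹) ^ n) ^ 2 *
      normalisedPressure (glueG T σ τ a z u (blowupTime T σ + σ ^ (2 * n) * s))
        (blowupPoint τ z + τ ^ n • y) := by
  rw [hU n s hs]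
  exact normalisedPressure_smul_stPull_slice _ _ (pow_pos h.τ_pos n) _ _ _ _

/-- On a window, `D(𝔘(s))(y) = a^{-n}τⁿ D𝔲(T₀ + σ^{2n}s)(x₀ + τⁿy)` (chain rule; the slices of
`𝔲` are `C^∞`). [folklore] -/
theorem ancient_fderiv_slice (h : IsSuperBlock T ν₀ τ σ a z G u)
    (hU : ∀ (n : ℕ) (s : ℝ), -blowupTime T σ ≤ σ ^ (2 * n) * s →
      U s = ((a⁻¹) ^ n • stPull (σ ^ (2 * n)) (τ ^ n) (blowupTime T σ) (blowupPoint τ z)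
        (glueG T σ τ a z u)) s)
    {n : ℕ} {s : ℝ} (hs : -blowupTime T σ ≤ σ ^ (2 * n) * s) (y : EuclideanSpace ℝ (Fin 3)) :
    fderiv ℝ (U s) y = ((a⁻¹) ^ n * τ ^ n) •
      fderiv ℝ (glueG T σ τ a z u (blowupTime T σ + σ ^ (2 * n) * s)) (blowupPoint τ z + τ ^ n • y) := by
  rw [hU n s hs]
  exact fderiv_smul_stPull_slice ((h.contDiff_glueG_slice _).differentiable (by simp)) y

end Ancient

end IsSuperBlock

end Summit.NavierStokesRegularity.NavierStokesRegularity.Theorems.TypeIliouvilleNoTypeIINegative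

end
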